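import Summits.Ventures.PercRepro.ProfileGapMonoThresholdSeriesExtension

/-!
# PercRepro — THE TWO COUNTS AT THE TOP THRESHOLD OF THE CO-RANK-4 FAMILY ON A MATROID WITH A PLANE OF `ν + 2`
POINTS (p5, gen 30; `proofs/P5-GM1.md` §41(b), (d), (f)(3); announced INBOX 13953)

Let `F = cl B` be a plane (`B ∈ Rq N 3`) with `ν + 2` points on a coloop-free matroid `N` of rank `R ≥ 4`, and
`O = E ∖ F` its series-class complement, `s := #O = R − 2`.  Every subset of `E` is `Y ∪ D` with `Y ⊆ O`, `D ⊆ F`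
(`card_filter_powerset_union_of_disjoint`: a filter count over `E.powerset` is a sum over `Y ⊆ O` of filter counts
over `F.powerset`; `sum_powerset_eq_sum_choose`: a count depending on `Y` through `#Y` is a binomial sum), and off
`Y = O` the rank formula of ProfileGapMonoThresholdSeriesExtension gives `ρ(Y ∪ D) = #Y + ρ(D)`,
`ρ(E ∖ (Y ∪ D)) = #(O ∖ Y) + ρ(F ∖ D)` (`rk_union_cases`).  At the top threshold `t = R − 1`:
**`card_top_demanding`** — the rank-`3` sets with complement rank exactly `R` number `A + s · Bℓ`, with
`A = #{D ⊆ F : ρ(D) = 3, ρ(O ∪ (F ∖ D)) = R}` (the spanning `D`, no series point) and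
`Bℓ = #{D ⊆ F : ρ(D) = 2, ρ(F ∖ D) = 3}` (one series point); **`card_top_targets`** — the rank-`4` sets with
complement rank `≥ R − 1` number `s · A₂ + C(s,2) · (Bℓ, or C₂ when s = 2)`, with
`A₂ = #{D ⊆ F : ρ(D) = 3, ρ(F ∖ D) ≥ 2}` and `C₂ = #{D ⊆ F : ρ(O ∪ D) = 4, ρ(F ∖ D) = 3}`.  The theorem is in
ProfileGapMonoThresholdTopNuTwo.  Nothing open is asserted.
-/
open scoped Matroid

namespace PercRepro.Cogirth

open Finset ThmH Skew Shadow Profile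

variable {α : Type} [DecidableEq α]

section SplitCount

variable {O F : Finset α}

/-- **Sums over the subsets of a disjoint union split into double sums**: `X ↦ (X ∩ O, X ∩ F)`. -/
theorem sum_powerset_union_of_disjoint (hOF : Disjoint O F) (f : Finset α → ℕ) :
    ∑ X ∈ (O ∪ F).powerset, f X = ∑ Y ∈ O.powerset, ∑ D ∈ F.powerset, f (Y ∪ D) := by
  have h := sum_product O.powerset F.powerset (fun p : Finset α × Finset α => f (p.1 ∪ p.2))
  simp only at h
  rw [← h]
  symm
  apply sum_nbij' (fun p => p.1 ∪ p.2) (fun X => (X ∩ O, X ∩ F))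
  · intro p hp
    rw [mem_product, mem_powerset, mem_powerset] at hp
    rw [mem_powerset]
    exact union_subset_union hp.1 hp.2
  · intro X _
    rw [mem_product, mem_powerset, mem_powerset]
    exact ⟨inter_subset_right, inter_subset_right⟩
  · rintro ⟨Y, D⟩ hp
    rw [mem_product, mem_powerset, mem_powerset] at hp
    have h1 : D ∩ O = ∅ := disjoint_iff_inter_eq_empty.1 (hOF.symm.mono_left hp.2)
    have h2 : Y ∩ F = ∅ := disjoint_iff_inter_eq_empty.1 (hOF.mono_left hp.1)
    simp only [Prod.mk.injEq]
    constructor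
    · rw [union_inter_distrib_right, inter_eq_left.2 hp.1, h1, union_empty]
    · rw [union_inter_distrib_right, inter_eq_left.2 hp.2, h2, empty_union]
  · intro X hX
    rw [mem_powerset] at hX
    simp only
    rw [← inter_union_distrib_left, inter_eq_left.2 hX]
  · intro _ _
    rfl

/-- **Counting a filter of the subsets of a disjoint union**, one inner count per `Y ⊆ O`. -/
theorem card_filter_powerset_union_of_disjoint (hOF : Disjoint O F) (P : Finset α → Prop) [DecidablePred P] :
    ((O ∪ F).powerset.filter P).card =
      ∑ Y ∈ O.powerset, (F.powerset.filter (fun D => P (Y ∪ D))).card := by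
  rw [card_filter, sum_powerset_union_of_disjoint hOF]
  apply sum_congr rfl
  intro Y _
  rw [card_filter]

omit [DecidableEq α] in
/-- A sum over `O.powerset` of a quantity depending on `Y` only through `#Y` is a binomial sum. -/
theorem sum_powerset_eq_sum_choose (h : ℕ → ℕ) (g : Finset α → ℕ) (hg : ∀ Y ∈ O.powerset, g Y = h Y.card) :
    ∑ Y ∈ O.powerset, g Y = ∑ k ∈ range (O.card + 1), O.card.choose k * h k := by
  rw [sum_congr rfl hg, sum_powerset_apply_card]
  simp only [smul_eq_mul]

/-- A binomial sum whose terms vanish from `k = 2` on. -/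
theorem sum_choose_eq_of_zero_from_two (s : ℕ) (h : ℕ → ℕ) (hz : ∀ k, 2 ≤ k → h k = 0) :
    ∑ k ∈ range (s + 1), s.choose k * h k = h 0 + s * h 1 := by
  rcases s with _ | s
  · simp
  · rw [sum_range_succ', sum_range_succ']
    have hzero : ∑ k ∈ range s, (s + 1).choose (k + 1 + 1) * h (k + 1 + 1) = 0 :=
      sum_eq_zero (fun k _ => by rw [hz _ (by omega), mul_zero])
    rw [hzero, zero_add, Nat.choose_one_right, Nat.choose_zero_right, one_mul, add_comm]

end SplitCount

section TopNuTwo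

variable {N : Matroid α} [N.Finite]

omit [DecidableEq α] in
/-- `ρ(D) ≤ 3` for a subset `D` of a plane `cl B`. -/
theorem rk_le_three_of_subset_clF {B : Finset α} (hB : B ∈ Rq N 3) {D : Finset α} (hD : D ⊆ clF N B) :
    rk N D ≤ 3 := by
  have hBrk : rk N B = 3 := rk_eq_of_eRk_eq_cq (mem_Rq.1 hB).2
  have := rk_mono' (M := N) hD
  rw [rk_clF, hBrk] at this
  exact this

/-- **The three cases of the rank of `Y ∪ D`** (`Y ⊆ O = E ∖ cl B`, `D ⊆ cl B`, the plane with `ν + 2` points on a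
coloop-free matroid): `Y = ∅`, `∅ ≠ Y ≠ O`, `Y = O`. -/
theorem rk_union_cases (hcf : ∀ z ∈ gr N, rk N ((gr N).erase z) = rk N (gr N)) {B : Finset α}
    (hB : B ∈ Rq N 3) (hlong : (clF N B).card + rk N (gr N) = (gr N).card + 2)
    {Y D : Finset α} (hY : Y ⊆ gr N \ clF N B) (hD : D ⊆ clF N B) (hYne : Y.Nonempty)
    (hYO : Y ≠ gr N \ clF N B) :
    rk N (Y ∪ D) = Y.card + rk N D ∧
      rk N (gr N \ (Y ∪ D)) = ((gr N \ clF N B) \ Y).card + rk N (clF N B \ D) := by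
  have hlong' : (clF N B).card + rk N (gr N) = (gr N).card + (4 - 2) := hlong
  obtain ⟨y, hy⟩ := hYne
  obtain ⟨x, hxO, hxY⟩ : ∃ x ∈ gr N \ clF N B, x ∉ Y := by
    by_contra h
    push Not at h
    exact hYO (Subset.antisymm hY h)
  have hYx : Y ⊆ (gr N \ clF N B).erase x := fun z hz => mem_erase.2 ⟨fun h => hxY (h ▸ hz), hY hz⟩
  exact ⟨rk_union_eq_of_long_flat (by norm_num) hcf hB hlong' hxO hYx hD,
    rk_sdiff_union_eq_of_long_flat (by norm_num) hcf hB hlong' hY hy hD⟩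

/-- The complement of `D ⊆ F` in `E` is `O ∪ (F ∖ D)`. -/
theorem sdiff_eq_union_sdiff_of_subset_clF (B : Finset α) {D : Finset α} (hD : D ⊆ clF N B) :
    gr N \ D = (gr N \ clF N B) ∪ (clF N B \ D) := by
  have hclg : clF N B ⊆ gr N := clF_subset_gr B
  ext z
  simp only [mem_sdiff, mem_union]
  constructor
  · rintro ⟨hz, hzD⟩
    by_cases hzF : z ∈ clF N B
    · exact Or.inr ⟨hzF, hzD⟩
    · exact Or.inl ⟨hz, hzF⟩
  · rintro (⟨hz, hzF⟩ | ⟨hzF, hzD⟩)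
    · exact ⟨hz, fun h => hzF (hD h)⟩
    · exact ⟨hclg hzF, hzD⟩

/-- The complement of `O ∪ D` (`D ⊆ F`) in `E` is `F ∖ D`. -/
theorem sdiff_union_sdiff_eq (B D : Finset α) :
    gr N \ ((gr N \ clF N B) ∪ D) = clF N B \ D := by
  have hclg : clF N B ⊆ gr N := clF_subset_gr B
  ext z
  simp only [mem_sdiff, mem_union, not_or, not_and, not_not]
  constructor
  · rintro ⟨hz, h1, h2⟩
    exact ⟨h1 hz, h2⟩
  · rintro ⟨hzF, hzD⟩
    exact ⟨hclg hzF, fun _ => hzF, hzD⟩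

omit [DecidableEq α] in
/-- `eRk = n` as a statement about `rk`. -/
theorem eRk_eq_iff_rk_eq {X : Finset α} {n : ℕ} : N.eRk (X : Set α) = (n : ℕ∞) ↔ rk N X = n := by
  rw [← coe_rk]
  exact Nat.cast_inj


/-- A binomial sum whose terms vanish from `k = 3` on. -/
theorem sum_choose_eq_of_zero_from_three (s : ℕ) (hs : 2 ≤ s) (h : ℕ → ℕ) (hz : ∀ k, 3 ≤ k → h k = 0) :
    ∑ k ∈ range (s + 1), s.choose k * h k = h 0 + s * h 1 + s.choose 2 * h 2 := by
  obtain ⟨m, rfl⟩ : ∃ m, s = m + 2 := ⟨s - 2, by omega⟩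
  rw [sum_range_succ', sum_range_succ', sum_range_succ']
  have hzero : ∑ k ∈ range m, (m + 2).choose (k + 1 + 1 + 1) * h (k + 1 + 1 + 1) = 0 :=
    sum_eq_zero (fun k _ => by rw [hz _ (by omega), mul_zero])
  rw [hzero, zero_add, Nat.choose_one_right, Nat.choose_zero_right, one_mul]
  ring

section Counts

variable {N : Matroid α} [N.Finite]

/-- `#O + 2 = ρ(E)` for the complement `O` of a plane with `ν + 2` points. -/
theorem card_sdiff_add_two_eq_rk {B : Finset α}
    (hlong : (clF N B).card + rk N (gr N) = (gr N).card + 2) :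
    (gr N \ clF N B).card + 2 = rk N (gr N) := by
  have h4 : (gr N \ clF N B).card = (gr N).card - (clF N B).card := card_sdiff_of_subset (clF_subset_gr B)
  have h5 : (clF N B).card ≤ (gr N).card := card_le_card (clF_subset_gr B)
  omega

/-- **THE DEMANDING SETS AT THE TOP THRESHOLD**: the rank-`3` sets with spanning complement number
`A + s · Bℓ` — the spanning `D ⊆ F` with `ρ(O ∪ (F ∖ D)) = ρ(E)`, and the sets `{y} ∪ D` with `ρ(D) = 2`,
`ρ(F ∖ D) = 3`. -/
theorem card_top_demanding (hcf : ∀ z ∈ gr N, rk N ((gr N).erase z) = rk N (gr N)) {B : Finset α}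
    (hB : B ∈ Rq N 3) (hlong : (clF N B).card + rk N (gr N) = (gr N).card + 2) (hR : 4 ≤ rk N (gr N)) :
    ((Rq N 3).filter (fun X => rk N (gr N \ X) = rk N (gr N))).card =
      ((clF N B).powerset.filter
          (fun D => rk N D = 3 ∧ rk N ((gr N \ clF N B) ∪ (clF N B \ D)) = rk N (gr N))).card +
        (gr N \ clF N B).card *
          ((clF N B).powerset.filter (fun D => rk N D = 2 ∧ rk N (clF N B \ D) = 3)).card := by
  have hs := card_sdiff_add_two_eq_rk hlong
  have hclg : clF N B ⊆ gr N := clF_subset_gr B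
  have hpow : (gr N).powerset = ((gr N \ clF N B) ∪ clF N B).powerset := by
    rw [sdiff_union_of_subset hclg]
  have hOF : Disjoint (gr N \ clF N B) (clF N B) := sdiff_disjoint
  have hRq : (Rq N 3).filter (fun X => rk N (gr N \ X) = rk N (gr N)) =
      ((gr N \ clF N B) ∪ clF N B).powerset.filter
        (fun (X : Finset α) => N.eRk (X : Set α) = ((3 : ℕ) : ℕ∞) ∧ rk N (gr N \ X) = rk N (gr N)) := by
    rw [← hpow]
    unfold Rq
    rw [filter_filter]
  rw [hRq, card_filter_powerset_union_of_disjoint hOF]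
  set A := ((clF N B).powerset.filter
    (fun D => rk N D = 3 ∧ rk N ((gr N \ clF N B) ∪ (clF N B \ D)) = rk N (gr N))).card with hA
  set Bl := ((clF N B).powerset.filter (fun D => rk N D = 2 ∧ rk N (clF N B \ D) = 3)).card with hBl
  rw [sum_powerset_eq_sum_choose (fun k => if k = 0 then A else if k = 1 then Bl else 0)]
  · rw [sum_choose_eq_of_zero_from_two _ _ (fun k hk => by
      simp only [show k ≠ 0 by omega, show k ≠ 1 by omega, if_false])]
    simp only [if_true, show (1 : ℕ) ≠ 0 by norm_num, if_false]
  · intro Y hY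
    rw [mem_powerset] at hY
    by_cases hY0 : Y = ∅
    · subst hY0
      simp only [card_empty, if_true]
      rw [hA]
      apply congrArg
      apply filter_congr
      intro D hD
      rw [mem_powerset] at hD
      rw [empty_union, eRk_eq_iff_rk_eq, sdiff_eq_union_sdiff_of_subset_clF B hD]
    by_cases hYO : Y = gr N \ clF N B
    · -- `Y = O`: the complement `F ∖ D` has rank `≤ 3 < ρ(E)`
      subst hYO
      have hk : (gr N \ clF N B).card ≠ 0 := by omega
      have hk1 : (gr N \ clF N B).card ≠ 1 := by omega
      simp only [hk, hk1, if_false]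
      rw [card_eq_zero, filter_eq_empty_iff]
      intro D hD
      rw [mem_powerset] at hD
      rintro ⟨_, h2⟩
      rw [sdiff_union_sdiff_eq] at h2
      have := rk_le_three_of_subset_clF hB (sdiff_subset : clF N B \ D ⊆ clF N B)
      omega
    · -- `∅ ≠ Y ≠ O`: the rank formulas
      have hYne : Y.Nonempty := nonempty_iff_ne_empty.2 hY0
      have hYcard : Y.card ≠ 0 := by
        rw [Ne, card_eq_zero]; exact hY0
      have hYlt : Y.card < (gr N \ clF N B).card := by
        have := card_le_card hY
        rcases this.lt_or_eq with h | h
        · exact h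
        · exact absurd (eq_of_subset_of_card_le hY h.ge) hYO
      by_cases hk1 : Y.card = 1
      · simp only [hk1, if_true]
        rw [hBl]
        apply congrArg
        apply filter_congr
        intro D hD
        rw [mem_powerset] at hD
        obtain ⟨h1, h2⟩ := rk_union_cases hcf hB hlong hY hD hYne hYO
        rw [eRk_eq_iff_rk_eq, h1, h2, card_sdiff_of_subset hY, hk1]
        have := rk_le_three_of_subset_clF hB (sdiff_subset : clF N B \ D ⊆ clF N B)
        constructor
        · rintro ⟨e1, e2⟩; constructor <;> omega
        · rintro ⟨e1, e2⟩; constructor <;> omega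
      · simp only [hYcard, hk1, if_false]
        rw [card_eq_zero, filter_eq_empty_iff]
        intro D hD
        rw [mem_powerset] at hD
        obtain ⟨h1, h2⟩ := rk_union_cases hcf hB hlong hY hD hYne hYO
        rw [eRk_eq_iff_rk_eq, h1, h2, card_sdiff_of_subset hY]
        have := rk_le_three_of_subset_clF hB (sdiff_subset : clF N B \ D ⊆ clF N B)
        rintro ⟨e1, e2⟩
        omega

/-- **THE TARGETS AT THE TOP THRESHOLD**: the rank-`4` sets with complement rank `≥ ρ(E) − 1` number
`s · A₂ + C(s,2) · (Bℓ, or C₂ when s = 2)`. -/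
theorem card_top_targets (hcf : ∀ z ∈ gr N, rk N ((gr N).erase z) = rk N (gr N)) {B : Finset α}
    (hB : B ∈ Rq N 3) (hlong : (clF N B).card + rk N (gr N) = (gr N).card + 2) (hR : 4 ≤ rk N (gr N)) :
    (levelSetCoQ N (rk N (gr N) - 1) 4).card =
      (gr N \ clF N B).card *
          ((clF N B).powerset.filter (fun D => rk N D = 3 ∧ 2 ≤ rk N (clF N B \ D))).card +
        (gr N \ clF N B).card.choose 2 *
          (if (gr N \ clF N B).card = 2 then
            ((clF N B).powerset.filter
              (fun D => rk N ((gr N \ clF N B) ∪ D) = 4 ∧ rk N (clF N B \ D) = 3)).card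
          else ((clF N B).powerset.filter (fun D => rk N D = 2 ∧ rk N (clF N B \ D) = 3)).card) := by
  have hs := card_sdiff_add_two_eq_rk hlong
  have hclg : clF N B ⊆ gr N := clF_subset_gr B
  have hpow : (gr N).powerset = ((gr N \ clF N B) ∪ clF N B).powerset := by
    rw [sdiff_union_of_subset hclg]
  have hOF : Disjoint (gr N \ clF N B) (clF N B) := sdiff_disjoint
  have hT : levelSetCoQ N (rk N (gr N) - 1) 4 =
      ((gr N \ clF N B) ∪ clF N B).powerset.filter
        (fun (X : Finset α) => N.eRk (X : Set α) = ((4 : ℕ) : ℕ∞) ∧ rk N (gr N) - 1 ≤ rk N (gr N \ X)) := by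
    rw [← hpow]
    ext X
    rw [mem_levelSetCoQ, mem_filter, mem_powerset]
    tauto
  rw [hT, card_filter_powerset_union_of_disjoint hOF]
  set A2 := ((clF N B).powerset.filter (fun D => rk N D = 3 ∧ 2 ≤ rk N (clF N B \ D))).card with hA2
  set Bl := ((clF N B).powerset.filter (fun D => rk N D = 2 ∧ rk N (clF N B \ D) = 3)).card with hBl
  set C2 := ((clF N B).powerset.filter
    (fun D => rk N ((gr N \ clF N B) ∪ D) = 4 ∧ rk N (clF N B \ D) = 3)).card with hC2
  set s := (gr N \ clF N B).card with hsdef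
  rw [sum_powerset_eq_sum_choose
    (fun k => if k = 1 then A2 else if k = 2 then (if s = 2 then C2 else Bl) else 0)]
  · rw [sum_choose_eq_of_zero_from_three s (by omega) _ (fun k hk => by
      simp only [show k ≠ 1 by omega, show k ≠ 2 by omega, if_false])]
    simp only [show (0 : ℕ) ≠ 1 by norm_num, show (0 : ℕ) ≠ 2 by norm_num, if_false, if_true,
      show (2 : ℕ) ≠ 1 by norm_num, zero_add]
  · intro Y hY
    rw [mem_powerset] at hY
    by_cases hY0 : Y = ∅
    · -- `Y = ∅`: no rank-`4` subset of the plane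
      subst hY0
      simp only [card_empty, show (0 : ℕ) ≠ 1 by norm_num, show (0 : ℕ) ≠ 2 by norm_num, if_false]
      rw [card_eq_zero, filter_eq_empty_iff]
      intro D hD
      rw [mem_powerset] at hD
      rintro ⟨h1, _⟩
      rw [empty_union, eRk_eq_iff_rk_eq] at h1
      have := rk_le_three_of_subset_clF hB hD
      omega
    by_cases hYO : Y = gr N \ clF N B
    · -- `Y = O`: only for `s = 2`
      subst hYO
      have hk1 : (gr N \ clF N B).card ≠ 1 := by omega
      simp only [hk1, if_false]
      by_cases hs2 : (gr N \ clF N B).card = 2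
      · rw [← hsdef] at hs2 ⊢
        simp only [hs2, if_true]
        rw [hC2]
        apply congrArg
        apply filter_congr
        intro D hD
        rw [mem_powerset] at hD
        rw [eRk_eq_iff_rk_eq, sdiff_union_sdiff_eq]
        have := rk_le_three_of_subset_clF hB (sdiff_subset : clF N B \ D ⊆ clF N B)
        constructor
        · rintro ⟨e1, e2⟩; constructor <;> omega
        · rintro ⟨e1, e2⟩; constructor <;> omega
      · rw [← hsdef] at hs2 ⊢
        simp only [hs2, if_false]
        rw [card_eq_zero, filter_eq_empty_iff]
        intro D hD
        rw [mem_powerset] at hD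
        rintro ⟨_, h2⟩
        rw [sdiff_union_sdiff_eq] at h2
        have := rk_le_three_of_subset_clF hB (sdiff_subset : clF N B \ D ⊆ clF N B)
        omega
    · -- `∅ ≠ Y ≠ O`: the rank formulas
      have hYne : Y.Nonempty := nonempty_iff_ne_empty.2 hY0
      have hYlt : Y.card < (gr N \ clF N B).card := by
        have := card_le_card hY
        rcases this.lt_or_eq with h | h
        · exact h
        · exact absurd (eq_of_subset_of_card_le hY h.ge) hYO
      obtain ⟨h1, h2⟩ : (∀ D ⊆ clF N B, rk N (Y ∪ D) = Y.card + rk N D) ∧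
          (∀ D ⊆ clF N B, rk N (gr N \ (Y ∪ D)) = ((gr N \ clF N B) \ Y).card + rk N (clF N B \ D)) :=
        ⟨fun D hD => (rk_union_cases hcf hB hlong hY hD hYne hYO).1,
         fun D hD => (rk_union_cases hcf hB hlong hY hD hYne hYO).2⟩
      by_cases hk1 : Y.card = 1
      · simp only [hk1, if_true]
        rw [hA2]
        apply congrArg
        apply filter_congr
        intro D hD
        rw [mem_powerset] at hD
        rw [eRk_eq_iff_rk_eq, h1 D hD, h2 D hD, card_sdiff_of_subset hY, hk1]
        have := rk_le_three_of_subset_clF hB (sdiff_subset : clF N B \ D ⊆ clF N B)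
        constructor
        · rintro ⟨e1, e2⟩; constructor <;> omega
        · rintro ⟨e1, e2⟩; constructor <;> omega
      by_cases hk2 : Y.card = 2
      · have hs2 : s ≠ 2 := by rw [hsdef]; omega
        simp only [hk2, hs2, if_false, if_true]
        rw [hBl]
        apply congrArg
        apply filter_congr
        intro D hD
        rw [mem_powerset] at hD
        rw [eRk_eq_iff_rk_eq, h1 D hD, h2 D hD, card_sdiff_of_subset hY, hk2]
        have := rk_le_three_of_subset_clF hB (sdiff_subset : clF N B \ D ⊆ clF N B)
        constructor
        · rintro ⟨e1, e2⟩; constructor <;> omega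
        · rintro ⟨e1, e2⟩; constructor <;> omega
      · simp only [hk1, hk2, if_false]
        rw [card_eq_zero, filter_eq_empty_iff]
        intro D hD
        rw [mem_powerset] at hD
        rw [eRk_eq_iff_rk_eq, h1 D hD, h2 D hD, card_sdiff_of_subset hY]
        have := rk_le_three_of_subset_clF hB (sdiff_subset : clF N B \ D ⊆ clF N B)
        have hY0' : Y.card ≠ 0 := by rw [Ne, card_eq_zero]; exact hY0
        rintro ⟨e1, e2⟩
        omega

end Counts
end TopNuTwo

end PercRepro.Cogirth
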